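import Mathlib
import HarnessLib

/-!
# The Hou–Li depletion law off the columnar family: exact defect, and the frozen node gradient

Kernel-checked algebra behind the soloist's "exact on-axis laws" (HOME `paper/sharpest.md` §5.2, claims C34–C37).

Setting (informal; the analytic meaning lives in the docstrings, the theorems certify the algebra). Axisymmetric
Navier–Stokes in the variables of T. Y. Hou and C. Li, *Dynamic stability of the three-dimensional axisymmetric
Navier–Stokes equations with swirl*, Comm. Pure Appl. Math. 61 (2008) 661–697 (arXiv:math/0608295), eqs. (13)–(16) and
§2: `u₁ = u_θ/r`, `ω₁ = ω_θ/r`, `ψ₁ = ψ_θ/r`, all smooth and even in `r`, with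
`D_t u₁ = 2ψ₁,z u₁ + νL u₁`, `D_t ω₁ = ∂_z(u₁²) + νL ω₁`, `−L ψ₁ = ω₁`, `L = ∂_r² + (3/r)∂_r + ∂_z²`,
`v_r = −r ψ₁,z`, `v_z = 2ψ₁ + r ψ₁,r`, `D_t = ∂_t + v_r∂_r + v_z∂_z`. Hou–Li's 1D model is the `r`-independent
(columnar) family, for which `S = u₁,z² + ω₁²` obeys the pointwise law (their eq. (6))
`D_t S = ν(L S − 2|∇u₁,z|² − 2|∇ω₁|²)` and hence a maximum principle. For GENERAL axisymmetric fields the same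
computation leaves an inviscid defect:

  `D_t S = ν(L S − 2|∇u₁,z|² − 2|∇ω₁|²) − (2/r)(∂_r v_z) ∂_z(u₁²) + 2(∂_r v_r − v_r/r) u₁,z² − 2(∂_z v_r) u₁,r u₁,z`,

which vanishes term by term on the columnar family (`∂_r v_z = 0`, `∂_r v_r = v_r/r`, `u₁,r = 0`) and reduces on the
axis to `−2 (∂_r²v_z)|_{r=0} ∂_z(u₁²)`: the depletion is destroyed exactly by the radial curvature of the axial jet
acting on the vertical gradient of the swirl. Below, every partial derivative VALUE at a point is a real variable
(a jet coordinate); the material derivatives are written out by the chain rule from the displayed equations, and the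
theorems state that the resulting polynomial identities hold for all values of the jets (multiplied through by `r` to
avoid division). They make no claim about solutions of the Navier–Stokes equations beyond this algebra.

Content:
* `houLi_defect_inviscid` — the inviscid identity above (times `r`), given the Biot–Savart relation `−Lψ₁ = ω₁` at the point;
* `houLi_viscous_part` — `2u₁,z·L(u₁,z) + 2ω₁·L(ω₁) = L S − 2|∇u₁,z|² − 2|∇ω₁|²` (times `r`), the product rule behind eq. (6);
* `trace_comm_bracket_sq`, `trace_comm_bracket_cube` — for square matrices, `tr(([M,G])G + G[M,G]) = 0` and the cubic
  analogue: the right-hand sides of `d/dt tr G²`, `d/dt tr G³` under the commutator flow `Ġ = MG − GM` vanish. By Cauchy's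
  formula the vorticity gradient `G = ∇ω` at a transported vorticity null evolves by conjugation with the flow-map Jacobian,
  i.e. by such a commutator flow with `M = ∇v`; at the stagnation point of an axisymmetric Euler flow odd in `z` this freezes
  `∂_z u₁(0,0,t)` (sharpest §5.2 (PL8));
* `hasDerivAt_axis_pressure_form` — on the axis, with `Ũ_z' = −2ṼU`, `Ṽ' = 2UŨ_z − π_z` (Hou–Li's variables `ũ = u₁`,
  `ṽ = −ψ₁,z`, `Ṽ = ṽ_z`, and `π = ∂_r²p|_{r=0}` the radial pressure Hessian), `(Ũ_z² + Ṽ²)' = −2π_zṼ`: all non-columnar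
  physics on the axis enters through the axial gradient of the radial pressure Hessian;
* `hasDerivAt_waist_product` — at an even stagnation point, with `m' = σm`, `k' = −σk + σ₂m` (`m = u₁(0,0)`, `k = u₁,zz(0,0)`,
  `σ = ∂_z v_z(0,0)`, `σ₂ = ∂_z³v_z(0,0)`), `(k·m)' = σ₂ m²`: the waist indicator `k·m` is non-increasing while the axial
  strain is maximal at the stagnation point along the axis (`σ₂ ≤ 0`), inviscidly.

The linter option `linter.dupNamespace` is disabled because the mandated landing namespace repeats the summit name by
design (D-0017). [problem: ns]
-/

set_option linter.dupNamespace false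

namespace Summit.NavierStokesRegularity.NavierStokesRegularity.Theorems

section JetAlgebra

variable {R : Type*} [CommRing R]

/-- INVISCID HOU–LI DEFECT IDENTITY (times `r`). Jet coordinates at a point `(r,z)`: `u, ur, uz, urz, uzz` for `u₁` and its
partials; `p, pr, pz, prr, prz, pzz` for `ψ₁`; `w` for `ω₁`. Derived quantities, each introduced by its defining equation:
`vr = −r pz`, `vz = 2p + r pr`, `vrz = ∂_z v_r = −r pzz`, `vrr = ∂_r v_r = −pz − r prz`, `vzz = ∂_z v_z = 2pz + r prz`,
`vzr = ∂_r v_z = 3pr + r prr`; the Euler time derivative of `u₁,z` by the chain rule,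
`utz = ∂_z(−v_r u₁,r − v_z u₁,z + 2ψ₁,z u₁) = −vrz·ur − vr·urz − vzz·uz − vz·uzz + 2pzz·u + 2pz·uz`;
the material derivatives `DtUz = utz + vr·urz + vz·uzz` and `DtW = ∂_z(u₁²) = 2u·uz`; and the Biot–Savart relation at the
point, `r·w = −(r·prr + 3pr + r·pzz)`. CONCLUSION: `r·(2uz·DtUz + 2w·DtW)` equals `r` times the defect
`−(2/r)·vzr·(2u·uz) + 2(vrr − vr/r)·uz² − 2vrz·ur·uz`, i.e. `−2·vzr·(2u·uz) + 2(r·vrr − vr)·uz² − 2r·vrz·ur·uz`. -/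
theorem houLi_defect_inviscid
    (r u ur uz urz uzz p pr pz prr prz pzz w vr vz vrz vrr vzz vzr utz DtUz DtW : R)
    (hvr : vr = -(r * pz)) (hvz : vz = 2 * p + r * pr) (hvrz : vrz = -(r * pzz))
    (hvrr : vrr = -pz - r * prz) (hvzz : vzz = 2 * pz + r * prz) (hvzr : vzr = 3 * pr + r * prr)
    (hutz : utz = -(vrz * ur) - vr * urz - vzz * uz - vz * uzz + 2 * pzz * u + 2 * pz * uz)
    (hDtUz : DtUz = utz + vr * urz + vz * uzz) (hDtW : DtW = 2 * u * uz)
    (hBS : r * w = -(r * prr + 3 * pr + r * pzz)) :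
    r * (2 * uz * DtUz + 2 * w * DtW) =
      -(2 * vzr * (2 * u * uz)) + 2 * (r * vrr - vr) * uz ^ 2 - 2 * r * vrz * ur * uz := by
  subst hvr hvz hvrz hvrr hvzz hvzr hutz hDtUz hDtW
  linear_combination (4 * u * uz) * hBS

/-- ON THE AXIS the defect is the jet curvature times the vertical swirl gradient: at `r = 0` the conclusion of
`houLi_defect_inviscid` (read before multiplying by `r`, with `vzr/r → ∂_r²v_z|_{r=0} =: vzrr0`) is
`2uz·DtUz + 2w·DtW = −2·vzrr0·(2u·uz)`. Stated directly from the on-axis equations `DtUz = 2Ψ_zz·U` (no transverse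
transport on the axis), `DtW = 2U·U_z`, and the on-axis Biot–Savart relation `Ψ_zz = −W − vzrr0` (`vzrr0 = Δ_yψ₁|_{r=0}`). -/
theorem houLi_defect_on_axis (U Uz W Pzz vzrr0 DtUz DtW : R)
    (hDtUz : DtUz = 2 * Pzz * U) (hDtW : DtW = 2 * U * Uz) (hBS : Pzz = -W - vzrr0) :
    2 * Uz * DtUz + 2 * W * DtW = -(2 * vzrr0 * (2 * U * Uz)) := by
  subst hDtUz hDtW hBS
  ring

/-- VISCOUS PART (times `r`), the product rule behind Hou–Li's eq. (6): with `S = uz² + w²` and its jets written by the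
product rule (`Sr = 2uz·uzr + 2w·wr`, `Srr = 2uzr² + 2uz·uzrr + 2wr² + 2w·wrr`, `Szz = 2uzz'² + 2uz·uzzz + 2wz² + 2w·wzz`,
where `uzz'` denotes `∂_z(u₁,z)`), one has `r·(2uz·L(uz) + 2w·L(w)) = r·L(S) − 2r(|∇uz|² + |∇w|²)`, `L = ∂_r² + (3/r)∂_r + ∂_z²`. -/
theorem houLi_viscous_part
    (r uz uzr uzz uzrr uzzz w wr wz wrr wzz Sr Srr Szz : R)
    (hSr : Sr = 2 * uz * uzr + 2 * w * wr)
    (hSrr : Srr = 2 * uzr ^ 2 + 2 * uz * uzrr + 2 * wr ^ 2 + 2 * w * wrr)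
    (hSzz : Szz = 2 * uzz ^ 2 + 2 * uz * uzzz + 2 * wz ^ 2 + 2 * w * wzz) :
    r * (2 * uz * (uzrr + uzzz) + 2 * w * (wrr + wzz)) + 3 * (2 * uz * uzr + 2 * w * wr) =
      (r * (Srr + Szz) + 3 * Sr) - 2 * r * ((uzr ^ 2 + uzz ^ 2) + (wr ^ 2 + wz ^ 2)) := by
  subst hSr hSrr hSzz
  ring

end JetAlgebra

section CommutatorFlow

variable {R : Type*} [CommRing R] {n : Type*} [Fintype n]

/-- ISOSPECTRALITY OF THE COMMUTATOR FLOW, quadratic invariant: for square matrices `M, G`,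
`tr(([M,G])·G + G·[M,G]) = 0`. Under `Ġ = MG − GM` this is `d/dt tr(G²) = 0`. (At a transported vorticity null,
Cauchy's formula makes `G = ∇ω` evolve by conjugation with the flow-map Jacobian, whose generator is this flow with
`M = ∇v`.) -/
theorem trace_comm_bracket_sq (M G : Matrix n n R) :
    Matrix.trace ((M * G - G * M) * G + G * (M * G - G * M)) = 0 := by
  have a1 : G * (M * G) = G * M * G := by simp only [Matrix.mul_assoc]
  have a2 : Matrix.trace (G * (G * M)) = Matrix.trace (M * G * G) := by
    rw [show G * (G * M) = (G * G) * M by simp only [Matrix.mul_assoc], Matrix.trace_mul_comm,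
      show M * (G * G) = M * G * G by simp only [Matrix.mul_assoc]]
  simp only [sub_mul, mul_sub, Matrix.trace_add, Matrix.trace_sub]
  rw [a1, a2]
  ring

/-- ISOSPECTRALITY OF THE COMMUTATOR FLOW, cubic invariant: `tr(([M,G])·G² + G·[M,G]·G + G²·[M,G]) = 0`, i.e.
`d/dt tr(G³) = 0` under `Ġ = MG − GM`. -/
theorem trace_comm_bracket_cube (M G : Matrix n n R) :
    Matrix.trace ((M * G - G * M) * G * G + G * (M * G - G * M) * G + G * G * (M * G - G * M)) = 0 := by
  have a1 : G * (M * G) * G = G * M * G * G := by simp only [Matrix.mul_assoc]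
  have a2 : G * G * (M * G) = G * (G * M) * G := by simp only [Matrix.mul_assoc]
  have a3 : Matrix.trace (G * G * (G * M)) = Matrix.trace (M * G * G * G) := by
    rw [show G * G * (G * M) = (G * G * G) * M by simp only [Matrix.mul_assoc], Matrix.trace_mul_comm,
      show M * (G * G * G) = M * G * G * G by simp only [Matrix.mul_assoc]]
  simp only [sub_mul, mul_sub, Matrix.trace_add, Matrix.trace_sub]
  rw [a1, a2, a3]
  ring

/-- Linear invariant: `tr([M,G]) = 0`. -/
theorem trace_comm_bracket (M G : Matrix n n R) : Matrix.trace (M * G - G * M) = 0 := by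
  rw [Matrix.trace_sub, Matrix.trace_mul_comm, sub_self]

end CommutatorFlow

section AxisODE

/-- PRESSURE FORM OF THE ON-AXIS LAW. Along the symmetry axis of an axisymmetric Euler flow, in Hou–Li's variables
`ũ = u₁|_{r=0} =: U`, `ṽ = −ψ₁,z|_{r=0}`, `Ũz = ∂_z ũ`, `Ṽ = ∂_z ṽ`, one has `Ũz' = −2ṼU` and `Ṽ' = 2UŨz − π_z` along axis
trajectories, where `π = ∂_r²p|_{r=0}` is the radial pressure Hessian (the 1D model is the case `π_z = 0`). Then
`(Ũz² + Ṽ²)' = −2π_z Ṽ`. Here: real functions of `t` with the stated derivatives at `t`; `Uz * Uz + V * V` is the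
pointwise product/sum of functions, `(Uz * Uz + V * V) s = Uz s * Uz s + V s * V s`. -/
theorem hasDerivAt_axis_pressure_form (U Uz V piz : ℝ → ℝ) (Uz' V' : ℝ) (t : ℝ)
    (hUz : HasDerivAt Uz Uz' t) (hV : HasDerivAt V V' t)
    (hUz' : Uz' = -2 * V t * U t) (hV' : V' = 2 * U t * Uz t - piz t) :
    HasDerivAt (Uz * Uz + V * V) (-2 * piz t * V t) t := by
  have e : Uz' * Uz t + Uz t * Uz' + (V' * V t + V t * V') = -2 * piz t * V t := by
    rw [hUz', hV']
    ring
  exact ((hUz.mul hUz).add (hV.mul hV)).congr_deriv e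

/-- THE WAIST PRODUCT LAW at an even stagnation point. With `m = u₁(0,0,t)`, `k = u₁,zz(0,0,t)`, `σ = ∂_z v_z(0,0,t)`,
`σ₂ = ∂_z³ v_z(0,0,t)`, the inviscid on-axis equations give `m' = σm` and `k' = −σk + σ₂m`; hence `(k·m)' = σ₂·m²`
(the strain drops out). So `k·m` is non-increasing as long as `σ₂ ≤ 0`, i.e. as long as the axial strain is maximal at
the stagnation point along the axis: a waist (`k > 0`) is driven toward a bulge (`k < 0`). Real functions of `t`;
`(k * m) s = k s * m s`. -/
theorem hasDerivAt_waist_product (m k σ σ₂ : ℝ → ℝ) (m' k' : ℝ) (t : ℝ)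
    (hm : HasDerivAt m m' t) (hk : HasDerivAt k k' t)
    (hm' : m' = σ t * m t) (hk' : k' = -(σ t) * k t + σ₂ t * m t) :
    HasDerivAt (k * m) (σ₂ t * m t ^ 2) t := by
  have e : k' * m t + k t * m' = σ₂ t * m t ^ 2 := by
    rw [hm', hk']
    ring
  exact (hk.mul hm).congr_deriv e

/-- Corollary form used in the text: if moreover `σ₂ t ≤ 0` then `deriv (k·m) t ≤ 0`. -/
theorem deriv_waist_product_nonpos (m k σ σ₂ : ℝ → ℝ) (m' k' : ℝ) (t : ℝ)
    (hm : HasDerivAt m m' t) (hk : HasDerivAt k k' t)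
    (hm' : m' = σ t * m t) (hk' : k' = -(σ t) * k t + σ₂ t * m t) (hσ₂ : σ₂ t ≤ 0) :
    deriv (k * m) t ≤ 0 := by
  rw [(hasDerivAt_waist_product m k σ σ₂ m' k' t hm hk hm' hk').deriv]
  exact mul_nonpos_of_nonpos_of_nonneg hσ₂ (sq_nonneg _)

end AxisODE

end Summit.NavierStokesRegularity.NavierStokesRegularity.Theorems
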